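import Literature.Geometry.Riemannian.GaussianShrinker
import Literature.Geometry.Riemannian.MCFAreaEvolution
import Literature.Geometry.Riemannian.HuiskenKernelIdentity
import Literature.Geometry.Riemannian.EuclideanHypersurfaceContact
import Literature.Geometry.Lorentzian.HypersurfaceHessian
import Literature.Geometry.Lorentzian.GreenIdentity
import HarnessLib

/-!
# Huisken's monotonicity formula for classical mean curvature flow — assembly file

Topic `Literature/Geometry/Riemannian`. **Huisken's monotonicity formula** for a classical mean
curvature flow `(F, ν)` of a compact `n`-manifold in `ℝⁿ⁺¹` (`IsClassicalMCF`):

  `d/dt|_{t₀} ∫_{M_t} ρ_{x₀,T} dμ_t = -∫_N ρ_{x₀,T}(F_{t₀}, t₀) (H - ⟪F_{t₀} - x₀, ν⟫/(2(T-t₀)))² dμ_{t₀} ≤ 0`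

(`IsClassicalMCF.hasDerivAt_gaussianIntegral`, `IsClassicalMCF.deriv_gaussianIntegral_nonpos`,
and the monotone form `IsClassicalMCF.antitoneOn_gaussianIntegral` — the Gaussian integral, which by
`IsClassicalMCF.gaussianIntegral_eq_integral` does not depend on the reference measure, is
non-increasing on `(a, b)`;
`ρ_{x₀,T}(x, t) = (4π(T-t))^{-n/2} e^{-‖x-x₀‖²/4(T-t)}`, the Gaussian integral written against the
fixed area measure `μ_{t₀}` with the density `θ_t` of `MCFAreaEvolution.lean`), assembled from the
tree's pieces:
`MCFAreaEvolution.lean` (differentiation of `∫ f dμ_t` along the flow), `HuiskenKernelIdentity.lean`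
(the pointwise identity for the backward heat kernel), `HypersurfaceHessian.lean`
(`Δ_{M}(φ|_M) = tr_{TM} Hess φ - H dφ(ν)`) and `GreenIdentity.lean` (`∫_M Δ_M u dμ = 0`).

Supporting content (the Euclidean-Hessian bridge between the tree's `PseudoRiemannianMetric.hessian`
and Mathlib's Fréchet derivatives, the static identities on an immersed hypersurface, the kernel
along a curve `hasDerivAt_huiskenKernel_comp`, `H = -⟪∂ₜF, ν⟫`):

* `hessian_euclideanMetric_eq_fderiv_fderiv` — `Hess_δ φ(x)(X₀, Y₀) = D²φ(x)(X₀)(Y₀)` for `φ`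
  of class `C²` at `x`;
* `contDiff_exp_neg_norm_sq_div`, `fderiv_fderiv_exp_neg_norm_sq_div`,
  `hessian_exp_neg_norm_sq_div` — the Gaussian factor `E(x) = e^{-‖x-p‖²/(4τ)}` is smooth and
  `Hess_δ E(x)(a, b) = E(x) (⟪x-p, a⟫⟪x-p, b⟫/(4τ²) - ⟪a, b⟫/(2τ))`;
* (static identities on an immersed compact hypersurface `f : N → ℝⁿ⁺¹` with unit normal `ν`)
  `orthonormal_mfderiv_frame`, `sum_sq_inner_mfderiv_frame` (`Σ ⟪y, df bᵢ⟫² = ‖y‖² - ⟪y, ν⟫²`),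
  `trace_hessian_exp_comp` — `tr_{f^*δ}(Hess E ∘ (df × df)) = E ((‖y‖² - ⟪y,ν⟫²)/(4τ²) - n/(2τ))`,
  `y = f w - p`; `integral_trace_hessian_sub_mul_meanCurvature_eq_zero` —
  `∫_N (tr_{f^*δ}(Hess φ ∘ (df × df)) - dφ(ν) H) dμ = 0` (`= ∫ Δ_{f^*δ}(φ ∘ f) dμ`).

Everything is PROVED; no definitions, no named facts.

## References

* G. Huisken, *Asymptotic behavior for singularities of the mean curvature flow*, J. Differential
  Geom. 31 (1990) 285–299, Thm. 3.1. [Huisken1990]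
* C. Mantegazza, *Lecture Notes on Mean Curvature Flow*, Birkhäuser 2011, §3.2. [Mantegazza2011]
* B. O'Neill, *Semi-Riemannian geometry*, Academic Press 1983, Ch. 3, Def. 3.48–Lemma 3.49
  (Hessian). [ONeill1983]
-/

noncomputable section

open Bundle Set Function Filter MeasureTheory Module Metric
open scoped Manifold ContDiff Topology RealInnerProductSpace

namespace Literature.Geometry.Riemannian

open Lorentzian Lorentzian.PseudoRiemannianMetric EuclideanHypersurface

section EuclideanHessian

variable {W : Type*} [NormedAddCommGroup W] [InnerProductSpace ℝ W] [FiniteDimensional ℝ W]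
  [CompleteSpace W]

omit [FiniteDimensional ℝ W] [CompleteSpace W] in
/-- `mvfderiv` on a vector space is `fderiv`. [folklore] -/
private theorem mvfderiv_vectorSpace_apply' {F : Type*} [NormedAddCommGroup F] [NormedSpace ℝ F]
    (f : W → F) (x v : W) :
    mvfderiv 𝓘(ℝ, W) f x v = fderiv ℝ f x v := by
  simp only [mvfderiv, mfderiv_eq_fderiv]
  rfl

/-- **The tree's Hessian of the Euclidean metric is the second Fréchet derivative**:
`Hess_δ φ(x)(X₀, Y₀) = D²φ(x)(X₀)(Y₀)` for `φ` of class `C²` at `x` (tree Hessian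
`hessian_apply_holds` on constant fields, `∇_X Y₀ = 0` for the flat connection). [folklore] -/
theorem hessian_euclideanMetric_eq_fderiv_fderiv {φ : W → ℝ} {x : W} (hφ : ContDiffAt ℝ 2 φ x)
    (X₀ Y₀ : W) :
    (euclideanMetric W).hessian φ x X₀ Y₀ = fderiv ℝ (fderiv ℝ φ) x X₀ Y₀ := by
  have hf : CMDiffAt 2 φ x := hφ.contMDiffAt
  set Xc : Π y : W, TangentSpace 𝓘(ℝ, W) y := fun _ ↦ (X₀ : W) with hXc
  set Yc : Π y : W, TangentSpace 𝓘(ℝ, W) y := fun _ ↦ (Y₀ : W) with hYc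
  have hX : MDiffAt (T% Xc) x :=
    (contMDiffAt_section_of_contDiffAt (k := 1) contDiffAt_const).mdifferentiableAt one_ne_zero
  have hY : MDiffAt (T% Yc) x :=
    (contMDiffAt_section_of_contDiffAt (k := 1) contDiffAt_const).mdifferentiableAt one_ne_zero
  have key := (euclideanMetric W).hessian_apply_holds hf hX hY
  rw [show X₀ = Xc x from rfl, show Y₀ = Yc x from rfl, key, PseudoRiemannianMetric.hessianAux]
  simp only [hXc, hYc, leviCivita_euclideanMetric_const, map_zero, sub_zero]
  have hfun : (fun y : W ↦ mvfderiv 𝓘(ℝ, W) φ y Y₀) = fun y ↦ fderiv ℝ φ y Y₀ :=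
    funext fun y ↦ mvfderiv_vectorSpace_apply' φ y Y₀
  rw [hfun, mvfderiv_vectorSpace_apply']
  -- `d/dx [Dφ(x) Y₀] X₀ = D²φ(x) X₀ Y₀`
  have hD : HasFDerivAt (fderiv ℝ φ) (fderiv ℝ (fderiv ℝ φ) x) x :=
    ((hφ.fderiv_right (m := 1) le_rfl).differentiableAt (by simp)).hasFDerivAt
  have h := hD.clm_apply (hasFDerivAt_const Y₀ x)
  rw [h.fderiv]
  simp

/-! ### The Hessian of the Gaussian factor -/

omit [FiniteDimensional ℝ W] [CompleteSpace W] in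
/-- The Gaussian factor `E(x) = e^{-‖x - p‖²/(4τ)}` is smooth. [folklore] -/
theorem contDiff_exp_neg_norm_sq_div (p : W) (τ : ℝ) :
    ContDiff ℝ ∞ fun z : W ↦ Real.exp (-‖z - p‖ ^ 2 / (4 * τ)) := by
  have h1 : ContDiff ℝ ∞ fun z : W ↦ ‖z - p‖ ^ 2 := (contDiff_norm_sq ℝ).comp (contDiff_id.sub contDiff_const)
  exact Real.contDiff_exp.comp ((h1.neg).div_const _)

omit [FiniteDimensional ℝ W] [CompleteSpace W] in
/-- **Second derivative of the Gaussian factor**: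
`D²E(x)(a)(b) = E(x) (⟪x - p, a⟫⟪x - p, b⟫/(4τ²) - ⟪a, b⟫/(2τ))` (product rule on
`DE(z) = -(E(z)/(2τ)) ⟪z - p, ·⟫`). [folklore] -/
theorem fderiv_fderiv_exp_neg_norm_sq_div (p : W) {τ : ℝ} (hτ : τ ≠ 0) (x a b : W) :
    fderiv ℝ (fderiv ℝ fun z : W ↦ Real.exp (-‖z - p‖ ^ 2 / (4 * τ))) x a b =
      Real.exp (-‖x - p‖ ^ 2 / (4 * τ)) *
        (⟪x - p, a⟫ * ⟪x - p, b⟫ / (4 * τ ^ 2) - ⟪a, b⟫ / (2 * τ)) := by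
  set E : W → ℝ := fun z ↦ Real.exp (-‖z - p‖ ^ 2 / (4 * τ)) with hE
  have hE' : ∀ z, HasFDerivAt E ((-(E z / (2 * τ))) • innerSL ℝ (z - p)) z :=
    fun z ↦ hasFDerivAt_exp_neg_norm_sq_div p z
  have hfd : fderiv ℝ E = fun z ↦ (-(E z / (2 * τ))) • innerSL ℝ (z - p) :=
    funext fun z ↦ (hE' z).fderiv
  -- differentiate `z ↦ c(z) • innerSL (z - p)` with `c = -E/(2τ)`
  have hc : HasFDerivAt (fun z : W ↦ -(E z / (2 * τ)))
      ((-(1 / (2 * τ))) • ((-(E x / (2 * τ))) • innerSL ℝ (x - p))) x := by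
    have h := (hE' x).const_mul (-(1 / (2 * τ)))
    refine h.congr_of_eventuallyEq (Eventually.of_forall fun z ↦ ?_)
    show -(E z / (2 * τ)) = -(1 / (2 * τ)) * E z
    ring
  have hL : HasFDerivAt (fun z : W ↦ innerSL ℝ (z - p)) (innerSL ℝ : W →L[ℝ] W →L[ℝ] ℝ) x := by
    have h := (innerSL ℝ : W →L[ℝ] W →L[ℝ] ℝ).hasFDerivAt.comp x ((hasFDerivAt_id x).sub_const p)
    rw [ContinuousLinearMap.comp_id] at h
    exact h
  have hprod : HasFDerivAt (fun z : W ↦ (-(E z / (2 * τ))) • innerSL ℝ (z - p))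
      ((-(E x / (2 * τ))) • (innerSL ℝ : W →L[ℝ] W →L[ℝ] ℝ) +
        ((-(1 / (2 * τ))) • ((-(E x / (2 * τ))) • innerSL ℝ (x - p))).smulRight (innerSL ℝ (x - p))) x :=
    hc.smul hL
  rw [hfd, hprod.fderiv]
  simp only [hE, FunLike.coe_add, Pi.add_apply, FunLike.coe_smul, Pi.smul_apply,
    ContinuousLinearMap.smulRight_apply, innerSL_apply_apply, smul_eq_mul]
  erw [innerSL_apply_apply]
  field_simp
  ring

/-- **The tree Hessian of the Gaussian factor**:
`Hess_δ E(x)(a, b) = E(x) (⟪x - p, a⟫⟪x - p, b⟫/(4τ²) - ⟪a, b⟫/(2τ))`. [folklore] -/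
theorem hessian_exp_neg_norm_sq_div (p : W) {τ : ℝ} (hτ : τ ≠ 0) (x a b : W) :
    (euclideanMetric W).hessian (fun z : W ↦ Real.exp (-‖z - p‖ ^ 2 / (4 * τ))) x a b =
      Real.exp (-‖x - p‖ ^ 2 / (4 * τ)) *
        (⟪x - p, a⟫ * ⟪x - p, b⟫ / (4 * τ ^ 2) - ⟪a, b⟫ / (2 * τ)) := by
  rw [hessian_euclideanMetric_eq_fderiv_fderiv
    (((contDiff_exp_neg_norm_sq_div p τ).of_le (by norm_cast)).contDiffAt) a b]
  exact fderiv_fderiv_exp_neg_norm_sq_div p hτ x a b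

end EuclideanHessian

/-! ### The static identities on an immersed hypersurface -/

section Static

variable {n : ℕ} {N : Type*} [TopologicalSpace N] [ChartedSpace (EuclideanSpace ℝ (Fin n)) N]
  [IsManifold (𝓡 n) ∞ N]

/-- **Images of an orthonormal frame are orthonormal**: if `b` is an `f^*δ`-orthonormal frame of
`T_w N` then `(df bᵢ)` is an orthonormal family of the ambient Euclidean space. [folklore] -/
theorem orthonormal_mfderiv_frame {f : N → EuclideanSpace ℝ (Fin (n + 1))}
    (hf : (euclideanMetric (EuclideanSpace ℝ (Fin (n + 1)))).IsSpacelikeImmersion (𝓡 n) f) (w : N)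
    {ι : Type*} [Fintype ι] {b : ι → TangentSpace (𝓡 n) w}
    (hb : ((euclideanMetric (EuclideanSpace ℝ (Fin (n + 1)))).inducedMetric f
      contMDiff_pullbackBilin_holds hf).IsOrthonormalFrame w b) :
    Orthonormal ℝ (fun i ↦ (show EuclideanSpace ℝ (Fin (n + 1)) from
      (mfderiv (𝓡 n) 𝓘(ℝ, EuclideanSpace ℝ (Fin (n + 1))) f w :
        TangentSpace (𝓡 n) w →L[ℝ] EuclideanSpace ℝ (Fin (n + 1))) (b i))) := by
  classical
  rw [orthonormal_iff_ite]
  intro i j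
  have hval : ∀ u v : TangentSpace (𝓡 n) w, ((euclideanMetric (EuclideanSpace ℝ (Fin (n + 1)))).inducedMetric f
      contMDiff_pullbackBilin_holds hf).val w u v =
      ⟪(mfderiv (𝓡 n) 𝓘(ℝ, EuclideanSpace ℝ (Fin (n + 1))) f w :
        TangentSpace (𝓡 n) w →L[ℝ] EuclideanSpace ℝ (Fin (n + 1))) u,
       (mfderiv (𝓡 n) 𝓘(ℝ, EuclideanSpace ℝ (Fin (n + 1))) f w :
        TangentSpace (𝓡 n) w →L[ℝ] EuclideanSpace ℝ (Fin (n + 1))) v⟫ := fun u v ↦ by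
    rw [inducedMetric_val, inducedBilin_apply, euclideanMetric_apply]
  split_ifs with hij
  · subst hij
    exact (hval (b i) (b i)).symm.trans (hb.1 i)
  · exact (hval (b i) (b j)).symm.trans (hb.2 i j hij)

/-- **Tangential norm in codimension one**: for an `f^*δ`-orthonormal basis `b` of `T_w N`
(`dim N = n`, ambient `ℝⁿ⁺¹`) and a unit normal `ν`, `Σᵢ ⟪y, df bᵢ⟫² = ‖y‖² - ⟪y, ν(w)⟫²` for
every ambient vector `y` (`{df bᵢ} ∪ {ν}` is an orthonormal basis). [folklore] -/
theorem sum_sq_inner_mfderiv_frame {f ν : N → EuclideanSpace ℝ (Fin (n + 1))}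
    (hf : (euclideanMetric (EuclideanSpace ℝ (Fin (n + 1)))).IsSpacelikeImmersion (𝓡 n) f)
    (hn : (euclideanMetric (EuclideanSpace ℝ (Fin (n + 1)))).IsUnitNormal (𝓡 n) f ν 1) (w : N)
    {b : Module.Basis (Fin n) ℝ (TangentSpace (𝓡 n) w)}
    (hb : ((euclideanMetric (EuclideanSpace ℝ (Fin (n + 1)))).inducedMetric f
      contMDiff_pullbackBilin_holds hf).IsOrthonormalFrame w b) (y : EuclideanSpace ℝ (Fin (n + 1))) :
    ∑ i, ⟪y, (mfderiv (𝓡 n) 𝓘(ℝ, EuclideanSpace ℝ (Fin (n + 1))) f w :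
        TangentSpace (𝓡 n) w →L[ℝ] EuclideanSpace ℝ (Fin (n + 1))) (b i)⟫ ^ 2 =
      ‖y‖ ^ 2 - ⟪y, ν w⟫ ^ 2 := by
  set A : TangentSpace (𝓡 n) w →L[ℝ] EuclideanSpace ℝ (Fin (n + 1)) :=
    mfderiv (𝓡 n) 𝓘(ℝ, EuclideanSpace ℝ (Fin (n + 1))) f w with hA
  set e : Fin n → EuclideanSpace ℝ (Fin (n + 1)) := fun i ↦ A (b i) with he
  have hon : Orthonormal ℝ e := orthonormal_mfderiv_frame hf w hb
  have hpy := norm_sq_eq_sum_sq_inner_add_norm_sq_sub hon y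
  set v : EuclideanSpace ℝ (Fin (n + 1)) := y - ∑ i, ⟪y, e i⟫ • e i with hv
  -- `v` is orthogonal to the tangent space `range df = span {eᵢ}`
  have hve : ∀ j, ⟪e j, v⟫ = 0 := fun j ↦ by
    rw [hv, inner_sub_right, inner_sum]
    have : ∑ i, ⟪e j, ⟪y, e i⟫ • e i⟫ = ⟪y, e j⟫ := by
      rw [Finset.sum_eq_single j]
      · rw [real_inner_smul_right, orthonormal_iff_ite.1 hon j j, if_pos rfl, mul_one]
      · intro i _ hij
        rw [real_inner_smul_right, orthonormal_iff_ite.1 hon j i, if_neg (Ne.symm hij), mul_zero]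
      · intro h; exact absurd (Finset.mem_univ j) h
    rw [this, real_inner_comm, sub_self]
  have hvA : ∀ u : TangentSpace (𝓡 n) w, ⟪A u, v⟫ = 0 := fun u ↦ by
    have hu : u = ∑ i, b.repr u i • b i := (b.sum_repr u).symm
    rw [hu, map_sum, sum_inner]
    refine Finset.sum_eq_zero fun i _ ↦ ?_
    rw [map_smul, real_inner_smul_left, show A (b i) = e i from rfl, hve i, mul_zero]
  -- `df` is injective and `dim T_w N + 1 = n + 1`
  have hAinj : Injective (A : TangentSpace (𝓡 n) w →ₗ[ℝ] EuclideanSpace ℝ (Fin (n + 1))) := by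
    refine (injective_iff_map_eq_zero _).2 fun u hu ↦ ?_
    by_contra hne
    have hpos := hf.inducedBilin_pos w hne
    rw [inducedBilin_apply, euclideanMetric_apply] at hpos
    have : ⟪A u, A u⟫ = 0 := by
      rw [show A u = 0 from hu, inner_zero_left]
    exact absurd this (ne_of_gt hpos)
  have hdim : finrank ℝ (TangentSpace (𝓡 n) w) + 1 = finrank ℝ (EuclideanSpace ℝ (Fin (n + 1))) := by
    rw [show finrank ℝ (TangentSpace (𝓡 n) w) = finrank ℝ (EuclideanSpace ℝ (Fin n)) from rfl,
      finrank_euclideanSpace, finrank_euclideanSpace, Fintype.card_fin, Fintype.card_fin]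
  have hνnorm : ‖ν w‖ = 1 := by
    have h : ⟪ν w, ν w⟫ = (1 : ℝ) := hn.val_self w
    rw [real_inner_self_eq_norm_sq] at h
    nlinarith [norm_nonneg (ν w)]
  have hνA : ∀ u : TangentSpace (𝓡 n) w, ⟪A u, ν w⟫ = 0 := fun u ↦ by
    rw [real_inner_comm]; exact hn.isNormalTo w u
  have hvν : v = ⟪ν w, v⟫ • ν w :=
    eq_inner_smul_of_forall_inner_eq_zero (A : TangentSpace (𝓡 n) w →ₗ[ℝ] EuclideanSpace ℝ (Fin (n + 1)))
      hAinj hdim hνnorm hνA hvA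
  -- `⟪ν, v⟫ = ⟪ν, y⟫` (the `eᵢ` are tangent)
  have hνe : ∀ i, ⟪ν w, e i⟫ = 0 := fun i ↦ by rw [real_inner_comm]; exact hνA (b i)
  have hνv : ⟪ν w, v⟫ = ⟪y, ν w⟫ := by
    rw [hv, inner_sub_right, inner_sum]
    have : ∑ i, ⟪ν w, ⟪y, e i⟫ • e i⟫ = 0 :=
      Finset.sum_eq_zero fun i _ ↦ by rw [real_inner_smul_right, hνe i, mul_zero]
    rw [this, sub_zero, real_inner_comm]
  have hvnorm : ‖v‖ ^ 2 = ⟪y, ν w⟫ ^ 2 := by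
    rw [hvν, norm_smul, mul_pow, hνnorm, one_pow, mul_one, Real.norm_eq_abs, sq_abs, hνv]
  calc ∑ i, ⟪y, A (b i)⟫ ^ 2 = ∑ i, ⟪y, e i⟫ ^ 2 := rfl
    _ = ‖y‖ ^ 2 - ⟪y, ν w⟫ ^ 2 := by linarith [hpy, hvnorm]


/-- **The tangential trace of the Hessian of the Gaussian factor**: for an immersed hypersurface
`f : N → ℝⁿ⁺¹` with unit normal `ν` and `E(x) = e^{-‖x-p‖²/(4τ)}`,
`tr_{f^*δ} (Hess_δ E ∘ (df × df))(w) = E(f w) ((‖y‖² - ⟪y, ν w⟫²)/(4τ²) - n/(2τ))`, `y = f w - p`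
(sum of `Hess E(eᵢ, eᵢ)` over the images `eᵢ = df bᵢ` of an orthonormal frame,
`hessian_exp_neg_norm_sq_div`, and `Σ ⟪y, eᵢ⟫² = ‖y‖² - ⟪y, ν⟫²`). [cite: Mantegazza2011, §3.2] -/
theorem trace_hessian_exp_comp {f ν : N → EuclideanSpace ℝ (Fin (n + 1))}
    (hf : (euclideanMetric (EuclideanSpace ℝ (Fin (n + 1)))).IsSpacelikeImmersion (𝓡 n) f)
    (hn : (euclideanMetric (EuclideanSpace ℝ (Fin (n + 1)))).IsUnitNormal (𝓡 n) f ν 1)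
    (p : EuclideanSpace ℝ (Fin (n + 1))) {τ : ℝ} (hτ : τ ≠ 0) (w : N) :
    ((euclideanMetric (EuclideanSpace ℝ (Fin (n + 1)))).inducedMetric f contMDiff_pullbackBilin_holds hf).trace w
      (((euclideanMetric (EuclideanSpace ℝ (Fin (n + 1)))).hessian
          (fun z ↦ Real.exp (-‖z - p‖ ^ 2 / (4 * τ))) (f w)).comp
        (mfderiv (𝓡 n) 𝓘(ℝ, EuclideanSpace ℝ (Fin (n + 1))) f w).toLinearMap
        (mfderiv (𝓡 n) 𝓘(ℝ, EuclideanSpace ℝ (Fin (n + 1))) f w).toLinearMap) =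
      Real.exp (-‖f w - p‖ ^ 2 / (4 * τ)) *
        ((‖f w - p‖ ^ 2 - ⟪f w - p, ν w⟫ ^ 2) / (4 * τ ^ 2) - (n : ℝ) / (2 * τ)) := by
  set g₁ := (euclideanMetric (EuclideanSpace ℝ (Fin (n + 1)))).inducedMetric f
    contMDiff_pullbackBilin_holds hf with hg₁
  set A : TangentSpace (𝓡 n) w →L[ℝ] EuclideanSpace ℝ (Fin (n + 1)) :=
    mfderiv (𝓡 n) 𝓘(ℝ, EuclideanSpace ℝ (Fin (n + 1))) f w with hA
  have hpos : ∀ u : TangentSpace (𝓡 n) w, u ≠ 0 → 0 < g₁.val w u u :=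
    fun u hu ↦ isRiemannian_inducedMetric _ _ contMDiff_pullbackBilin_holds hf w u hu
  haveI : FiniteDimensional ℝ (TangentSpace (𝓡 n) w) :=
    inferInstanceAs (FiniteDimensional ℝ (EuclideanSpace ℝ (Fin n)))
  obtain ⟨b, hb⟩ := g₁.exists_basis_isOrthonormalFrame hpos (m := n)
    (by exact finrank_euclideanSpace_fin)
  set e : Fin n → EuclideanSpace ℝ (Fin (n + 1)) := fun i ↦ A (b i) with he
  have hon : Orthonormal ℝ e := orthonormal_mfderiv_frame hf w hb
  set y : EuclideanSpace ℝ (Fin (n + 1)) := f w - p with hy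
  rw [g₁.trace_eq_sum_of_isOrthonormalFrame b hb]
  have hterm : ∀ i, (((euclideanMetric (EuclideanSpace ℝ (Fin (n + 1)))).hessian
      (fun z ↦ Real.exp (-‖z - p‖ ^ 2 / (4 * τ))) (f w)).comp
        (mfderiv (𝓡 n) 𝓘(ℝ, EuclideanSpace ℝ (Fin (n + 1))) f w).toLinearMap
        (mfderiv (𝓡 n) 𝓘(ℝ, EuclideanSpace ℝ (Fin (n + 1))) f w).toLinearMap)
        (b i) (b i) =
      Real.exp (-‖y‖ ^ 2 / (4 * τ)) * (⟪y, e i⟫ ^ 2 / (4 * τ ^ 2) - 1 / (2 * τ)) := by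
    intro i
    rw [LinearMap.BilinForm.comp_apply]
    have h := hessian_exp_neg_norm_sq_div p hτ (f w) (e i) (e i)
    have hii : ⟪e i, e i⟫ = (1 : ℝ) := by
      rw [orthonormal_iff_ite.1 hon i i, if_pos rfl]
    rw [hii] at h
    refine h.trans ?_
    simp only [hy]
    ring
  have hs : ∑ i, ⟪y, e i⟫ ^ 2 = ‖y‖ ^ 2 - ⟪y, ν w⟫ ^ 2 := sum_sq_inner_mfderiv_frame hf hn w hb y
  rw [Finset.sum_congr rfl fun i _ ↦ hterm i, ← Finset.mul_sum, Finset.sum_sub_distrib,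
    Finset.sum_const, Finset.card_univ, Fintype.card_fin, nsmul_eq_mul, ← Finset.sum_div, hs]
  ring

variable [CompactSpace N] [T2Space N] [MeasurableSpace N] [BorelSpace N]

/-- **`∫_N Δ_{f^*δ}(φ ∘ f) dμ = 0` made explicit**: for an immersed compact hypersurface
`f : N → ℝⁿ⁺¹` with smooth unit normal `ν` and `φ ∈ C²(ℝⁿ⁺¹)`,
`∫_N (tr_{f^*δ}(Hess_δ φ ∘ (df × df)) - dφ(ν) H) dμ_{f^*δ} = 0`
(`dalembertian_comp_eq`, `HypersurfaceHessian.lean`, integrated with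
`integral_dalembertian_eq_zero`, `GreenIdentity.lean`). [cite: Mantegazza2011, §3.2]
[cite: ONeill1983, Ch. 4, Lemma 3 and Lemma 4] -/
theorem integral_trace_hessian_sub_mul_meanCurvature_eq_zero
    {f ν : N → EuclideanSpace ℝ (Fin (n + 1))}
    (hf : (euclideanMetric (EuclideanSpace ℝ (Fin (n + 1)))).IsSpacelikeImmersion (𝓡 n) f)
    (hνl : ContMDiff (𝓡 n) 𝓘(ℝ, EuclideanSpace ℝ (Fin (n + 1))).tangent ∞ fun x ↦
      (TotalSpace.mk' (EuclideanSpace ℝ (Fin (n + 1))) (f x) (ν x) :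
        TangentBundle 𝓘(ℝ, EuclideanSpace ℝ (Fin (n + 1))) (EuclideanSpace ℝ (Fin (n + 1)))))
    (hn : (euclideanMetric (EuclideanSpace ℝ (Fin (n + 1)))).IsUnitNormal (𝓡 n) f ν 1)
    {φ : EuclideanSpace ℝ (Fin (n + 1)) → ℝ} (hφ : ContDiff ℝ 2 φ) :
    ∫ w, (((euclideanMetric (EuclideanSpace ℝ (Fin (n + 1)))).inducedMetric f
        contMDiff_pullbackBilin_holds hf).trace w
        (((euclideanMetric (EuclideanSpace ℝ (Fin (n + 1)))).hessian φ (f w)).comp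
          (mfderiv (𝓡 n) 𝓘(ℝ, EuclideanSpace ℝ (Fin (n + 1))) f w).toLinearMap
          (mfderiv (𝓡 n) 𝓘(ℝ, EuclideanSpace ℝ (Fin (n + 1))) f w).toLinearMap) -
        mvfderiv 𝓘(ℝ, EuclideanSpace ℝ (Fin (n + 1))) φ (f w) (ν w) *
          (euclideanMetric (EuclideanSpace ℝ (Fin (n + 1)))).meanCurvature f
            contMDiff_pullbackBilin_holds hf ν w)
      ∂riemannianMeasure ((euclideanMetric (EuclideanSpace ℝ (Fin (n + 1)))).inducedRiemannianMetric f
        contMDiff_pullbackBilin_holds hf) = 0 := by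
  haveI : (ofRiemannian ((euclideanMetric (EuclideanSpace ℝ (Fin (n + 1)))).inducedRiemannianMetric f
      contMDiff_pullbackBilin_holds hf)).HasLeviCivita :=
    ((euclideanMetric (EuclideanSpace ℝ (Fin (n + 1)))).inducedMetric f
      contMDiff_pullbackBilin_holds hf).hasLeviCivita
  haveI := ((euclideanMetric (EuclideanSpace ℝ (Fin (n + 1)))).inducedMetric f
    contMDiff_pullbackBilin_holds hf).hasLeviCivita
  have hdim : finrank ℝ (EuclideanSpace ℝ (Fin (n + 1))) = finrank ℝ (EuclideanSpace ℝ (Fin n)) + 1 := by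
    rw [finrank_euclideanSpace_fin, finrank_euclideanSpace_fin]
  have hφm : CMDiff 2 φ := hφ.contMDiff
  have hpt : ∀ w, ((euclideanMetric (EuclideanSpace ℝ (Fin (n + 1)))).inducedMetric f
      contMDiff_pullbackBilin_holds hf).dalembertian (fun y ↦ φ (f y)) w = _ :=
    fun w ↦ PseudoRiemannianMetric.dalembertian_comp_eq (euclideanMetric (EuclideanSpace ℝ (Fin (n + 1))))
      contMDiff_pullbackBilin_holds hf hνl hn one_ne_zero hdim hφm w
  have hcomp : ContMDiff (𝓡 n) 𝓘(ℝ, ℝ) 2 (fun y ↦ φ (f y)) :=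
    hφm.comp (hf.contMDiff.of_le (by norm_cast))
  have h0 : ∫ w, ((euclideanMetric (EuclideanSpace ℝ (Fin (n + 1)))).inducedMetric f
      contMDiff_pullbackBilin_holds hf).dalembertian (fun y ↦ φ (f y)) w
      ∂riemannianMeasure ((euclideanMetric (EuclideanSpace ℝ (Fin (n + 1)))).inducedRiemannianMetric f
        contMDiff_pullbackBilin_holds hf) = 0 :=
    integral_dalembertian_eq_zero
      (h := (euclideanMetric (EuclideanSpace ℝ (Fin (n + 1)))).inducedRiemannianMetric f
        contMDiff_pullbackBilin_holds hf) hcomp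
  rw [← h0]
  refine integral_congr_ae (Eventually.of_forall fun w ↦ ?_)
  rw [hpt w, div_one]

end Static

/-! ### Huisken's monotonicity formula -/

section KernelAlongCurve

variable {V : Type*} [NormedAddCommGroup V] [InnerProductSpace ℝ V]

/-- **The backward heat kernel along a curve**: for `γ` with `γ'(t) = γ'`, `t < T`,
`d/ds|_t [(4π(T-s))^{-k/2} e^{-‖γ(s)-x₀‖²/(4(T-s))}]
  = ρ · (k/(2τ) - ‖y‖²/(4τ²) - ⟪y, γ'⟫/(2τ))`, `τ = T - t`, `y = γ(t) - x₀`, `ρ` the kernel value.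
[cite: Mantegazza2011, §3.2] -/
theorem hasDerivAt_huiskenKernel_comp {γ : ℝ → V} {γ' : V} {t T : ℝ} (hγ : HasDerivAt γ γ' t)
    (ht : t < T) (x₀ : V) (k : ℕ) :
    HasDerivAt (fun s ↦ (4 * Real.pi * (T - s)) ^ (-(k : ℝ) / 2) *
        Real.exp (-‖γ s - x₀‖ ^ 2 / (4 * (T - s))))
      ((4 * Real.pi * (T - t)) ^ (-(k : ℝ) / 2) * Real.exp (-‖γ t - x₀‖ ^ 2 / (4 * (T - t))) *
        ((k : ℝ) / (2 * (T - t)) - ‖γ t - x₀‖ ^ 2 / (4 * (T - t) ^ 2) -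
          ⟪γ t - x₀, γ'⟫ / (2 * (T - t)))) t := by
  have hτ : 0 < T - t := sub_pos.2 ht
  have hTs : HasDerivAt (fun s : ℝ ↦ T - s) (-1) t := by
    have h := (hasDerivAt_id t).const_sub T
    refine h.congr_deriv ?_
    simp
  -- the normalisation
  have hc : HasDerivAt (fun s : ℝ ↦ (4 * Real.pi * (T - s)) ^ (-(k : ℝ) / 2))
      ((4 * Real.pi * (T - t)) ^ (-(k : ℝ) / 2) * (-(k : ℝ) / (2 * (T - t))) * (-1)) t :=
    (hasDerivAt_normalization k hτ).comp t hTs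
  -- the exponent
  have hy : HasDerivAt (fun s ↦ γ s - x₀) γ' t := hγ.sub_const x₀
  have hu : HasDerivAt (fun s ↦ ⟪γ s - x₀, γ s - x₀⟫) (⟪γ t - x₀, γ'⟫ + ⟪γ', γ t - x₀⟫) t :=
    hy.inner ℝ hy
  have hv : HasDerivAt (fun s : ℝ ↦ 4 * (T - s)) (4 * (-1)) t := hTs.const_mul 4
  have hq : HasDerivAt (fun s ↦ -(⟪γ s - x₀, γ s - x₀⟫ / (4 * (T - s))))
      (-(((⟪γ t - x₀, γ'⟫ + ⟪γ', γ t - x₀⟫) * (4 * (T - t)) -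
        ⟪γ t - x₀, γ t - x₀⟫ * (4 * (-1))) / (4 * (T - t)) ^ 2)) t :=
    (hu.div hv (by positivity)).neg
  have hexp := hq.exp
  have hprod := hc.mul hexp
  have hfun : (fun s ↦ (4 * Real.pi * (T - s)) ^ (-(k : ℝ) / 2) *
      Real.exp (-‖γ s - x₀‖ ^ 2 / (4 * (T - s)))) = fun s ↦
      (4 * Real.pi * (T - s)) ^ (-(k : ℝ) / 2) *
        Real.exp (-(⟪γ s - x₀, γ s - x₀⟫ / (4 * (T - s)))) := by
    funext s
    simp only [real_inner_self_eq_norm_sq, neg_div]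
  rw [hfun]
  have hprod' : HasDerivAt (fun s ↦ (4 * Real.pi * (T - s)) ^ (-(k : ℝ) / 2) *
      Real.exp (-(⟪γ s - x₀, γ s - x₀⟫ / (4 * (T - s))))) _ t := hprod
  refine hprod'.congr_deriv ?_
  have hτ0 : T - t ≠ 0 := hτ.ne'
  rw [real_inner_self_eq_norm_sq, real_inner_comm γ', ← neg_div]
  field_simp
  ring

end KernelAlongCurve


section Monotonicity

variable {n : ℕ} {N : Type*} [TopologicalSpace N] [ChartedSpace (EuclideanSpace ℝ (Fin n)) N]
  [IsManifold (𝓡 n) ∞ N]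
  {F : ℝ → N → EuclideanSpace ℝ (Fin (n + 1))}
  {ν : (t : ℝ) → NormalField (𝓡 (n + 1)) (F t)} {a b : ℝ}

/-- `H = -⟪∂ₜF, ν⟫` along a classical mean curvature flow (`∂ₜF = -Hν`, `‖ν‖ = 1`); in particular
`H` is continuous. [folklore] -/
theorem IsClassicalMCF.meanCurvature_eq_neg_inner_deriv
    (h : IsClassicalMCF (euclideanMetric (EuclideanSpace ℝ (Fin (n + 1)))) F ν a b) {t : ℝ}
    (ht : t ∈ Icc a b) (y : N) :
    (euclideanMetric _).meanCurvature (F t) contMDiff_pullbackBilin_holds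
        (h.isSpacelikeImmersion t ht) (ν t) y = -⟪deriv (fun s ↦ F s y) t, ν t y⟫ := by
  set w : EuclideanSpace ℝ (Fin (n + 1)) := ν t y with hw
  set H₁ : ℝ := (euclideanMetric _).meanCurvature (F t) contMDiff_pullbackBilin_holds
    (h.isSpacelikeImmersion t ht) (ν t) y with hH₁
  have hv : deriv (fun s ↦ F s y) t = (-H₁) • w := by
    rw [← mfderiv_slice_apply_one]
    exact h.velocity_eq t ht y
  have hν : ⟪w, w⟫ = (1 : ℝ) := (h.isUnitNormal t ht).val_self y
  rw [hv, real_inner_smul_left, hν]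
  ring

omit [IsManifold (𝓡 n) ∞ N] in
/-- The differential of the Gaussian factor on a vector: `dE_x(v) = -(E(x)/(2τ)) ⟪x - p, v⟫`.
[folklore] -/
theorem mvfderiv_exp_neg_norm_sq_div_apply (p : EuclideanSpace ℝ (Fin (n + 1))) (τ : ℝ)
    (x v : EuclideanSpace ℝ (Fin (n + 1))) :
    mvfderiv 𝓘(ℝ, EuclideanSpace ℝ (Fin (n + 1))) (fun z ↦ Real.exp (-‖z - p‖ ^ 2 / (4 * τ))) x v =
      -(Real.exp (-‖x - p‖ ^ 2 / (4 * τ)) / (2 * τ)) * ⟪x - p, v⟫ := by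
  have h := (hasFDerivAt_exp_neg_norm_sq_div p (τ := τ) x).fderiv
  simp only [mvfderiv, mfderiv_eq_fderiv]
  show fderiv ℝ (fun z ↦ Real.exp (-‖z - p‖ ^ 2 / (4 * τ))) x v = _
  rw [h, FunLike.coe_smul, Pi.smul_apply, innerSL_apply_apply, smul_eq_mul]

variable [CompactSpace N] [T2Space N] [MeasurableSpace N] [BorelSpace N]

/-- **Huisken's monotonicity formula for a classical mean curvature flow** (derivative form).
For a classical mean curvature flow `(F, ν)` of a compact `n`-manifold in `ℝⁿ⁺¹` on `[a, b]`,
`x₀ ∈ ℝⁿ⁺¹`, `T ≥ b` and the backward heat kernel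
`ρ(x, t) = (4π(T-t))^{-n/2} e^{-‖x-x₀‖²/4(T-t)}`, the Gaussian integral
`Φ(t) = ∫_{M_t} ρ(·, t) dμ_t` (written against the fixed measure `μ_{t₀}` with the density `θ_t`,
`MCFAreaEvolution.lean`) satisfies at every `t₀ ∈ (a, b)`

  `Φ'(t₀) = -∫_N ρ(F_{t₀}, t₀) · (H - ⟪F_{t₀} - x₀, ν⟫/(2(T-t₀)))² dμ_{t₀} ≤ 0`.

Proof: `MCFAreaEvolution` (`∂ₜ(f θ) → ∂ₜf - H²f`), the kernel derivative along the flow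
(`hasDerivAt_huiskenKernel_comp`, `∂ₜF = -Hν`), the divergence identity
`∫ (tr Hess E - dE(ν) H) dμ = 0` and the tangential trace of `Hess E`
(`HuiskenMonotonicity.lean`), and the algebra of Huisken's identity.
[cite: Huisken1990, Thm. 3.1] [cite: Mantegazza2011, Thm. 3.2.7 (proof)] -/
theorem IsClassicalMCF.hasDerivAt_gaussianIntegral
    (h : IsClassicalMCF (euclideanMetric (EuclideanSpace ℝ (Fin (n + 1)))) F ν a b) {t₀ : ℝ}
    (ht₀ : t₀ ∈ Ioo a b) (x₀ : EuclideanSpace ℝ (Fin (n + 1))) {T : ℝ} (hT : b ≤ T) :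
    HasDerivAt (fun t ↦ ∫ w, ((4 * Real.pi * (T - t)) ^ (-(n : ℝ) / 2) *
          Real.exp (-‖F t w - x₀‖ ^ 2 / (4 * (T - t)))) *
        (Real.sqrt (Matrix.of fun i j ↦
          (euclideanMetric (EuclideanSpace ℝ (Fin (n + 1)))).inducedBilin (𝓡 n) (F t) w
            ((trivializationAt (EuclideanSpace ℝ (Fin n)) (TangentSpace (𝓡 n)) w).localFrame
              (EuclideanSpace.basisFun (Fin n) ℝ).toBasis i w)
            ((trivializationAt (EuclideanSpace ℝ (Fin n)) (TangentSpace (𝓡 n)) w).localFrame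
              (EuclideanSpace.basisFun (Fin n) ℝ).toBasis j w)).det /
         Real.sqrt (Matrix.of fun i j ↦
          (euclideanMetric (EuclideanSpace ℝ (Fin (n + 1)))).inducedBilin (𝓡 n) (F t₀) w
            ((trivializationAt (EuclideanSpace ℝ (Fin n)) (TangentSpace (𝓡 n)) w).localFrame
              (EuclideanSpace.basisFun (Fin n) ℝ).toBasis i w)
            ((trivializationAt (EuclideanSpace ℝ (Fin n)) (TangentSpace (𝓡 n)) w).localFrame
              (EuclideanSpace.basisFun (Fin n) ℝ).toBasis j w)).det)
        ∂riemannianMeasure ((euclideanMetric (EuclideanSpace ℝ (Fin (n + 1)))).inducedRiemannianMetric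
          (F t₀) contMDiff_pullbackBilin_holds (h.isSpacelikeImmersion t₀ (Ioo_subset_Icc_self ht₀))))
      (-∫ w, ((4 * Real.pi * (T - t₀)) ^ (-(n : ℝ) / 2) *
          Real.exp (-‖F t₀ w - x₀‖ ^ 2 / (4 * (T - t₀)))) *
        ((euclideanMetric _).meanCurvature (F t₀) contMDiff_pullbackBilin_holds
            (h.isSpacelikeImmersion t₀ (Ioo_subset_Icc_self ht₀)) (ν t₀) w -
          ⟪F t₀ w - x₀, ν t₀ w⟫ / (2 * (T - t₀))) ^ 2
        ∂riemannianMeasure ((euclideanMetric (EuclideanSpace ℝ (Fin (n + 1)))).inducedRiemannianMetric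
          (F t₀) contMDiff_pullbackBilin_holds (h.isSpacelikeImmersion t₀ (Ioo_subset_Icc_self ht₀))))
      t₀ := by
  obtain ⟨U, hU, hIU, hF⟩ := h.contMDiffOn
  have ht₀' : t₀ ∈ Icc a b := Ioo_subset_Icc_self ht₀
  have hτ : 0 < T - t₀ := by linarith [ht₀.2]
  -- the integrand `f(t, w) = ρ(F_t w, t)` and its time derivative
  have hfc : ContinuousOn (uncurry fun t w ↦ (4 * Real.pi * (T - t)) ^ (-(n : ℝ) / 2) *
      Real.exp (-‖F t w - x₀‖ ^ 2 / (4 * (T - t)))) (Ioo a b ×ˢ univ) := by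
    have hFc : ContinuousOn (fun q : ℝ × N ↦ F q.1 q.2) (Ioo a b ×ˢ univ) :=
      hF.continuousOn.mono (Set.prod_mono (Ioo_subset_Icc_self.trans hIU) subset_rfl)
    have hτc : ContinuousOn (fun q : ℝ × N ↦ T - q.1) (Ioo a b ×ˢ univ) :=
      (continuous_const.sub continuous_fst).continuousOn
    have hτ0 : ∀ q ∈ Ioo a b ×ˢ (univ : Set N), 0 < T - q.1 := fun q hq ↦ by
      have := hq.1.2; linarith
    refine ContinuousOn.mul ?_ ?_
    · exact ((continuousOn_const.mul hτc).rpow_const fun q hq ↦ Or.inl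
        (mul_pos (mul_pos four_pos Real.pi_pos) (hτ0 q hq)).ne')
    · refine (ContinuousOn.div ?_ (continuousOn_const.mul hτc) fun q hq ↦ ?_).rexp
      · exact ((hFc.sub continuousOn_const).norm.pow 2).neg
      · exact (mul_pos four_pos (hτ0 q hq)).ne'
  have hf'c : ContinuousOn (uncurry fun t w ↦ (4 * Real.pi * (T - t)) ^ (-(n : ℝ) / 2) *
      Real.exp (-‖F t w - x₀‖ ^ 2 / (4 * (T - t))) *
      ((n : ℝ) / (2 * (T - t)) - ‖F t w - x₀‖ ^ 2 / (4 * (T - t) ^ 2) -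
        ⟪F t w - x₀, deriv (fun s ↦ F s w) t⟫ / (2 * (T - t)))) (Ioo a b ×ˢ univ) := by
    have hFc : ContinuousOn (fun q : ℝ × N ↦ F q.1 q.2) (Ioo a b ×ˢ univ) :=
      hF.continuousOn.mono (Set.prod_mono (Ioo_subset_Icc_self.trans hIU) subset_rfl)
    have hDc : ContinuousOn (fun q : ℝ × N ↦ deriv (fun s ↦ F s q.2) q.1) (Ioo a b ×ˢ univ) :=
      (continuousOn_timeDeriv hU hF).mono (Set.prod_mono (Ioo_subset_Icc_self.trans hIU) subset_rfl)
    have hτc : ContinuousOn (fun q : ℝ × N ↦ T - q.1) (Ioo a b ×ˢ univ) :=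
      (continuous_const.sub continuous_fst).continuousOn
    have hτ0 : ∀ q ∈ Ioo a b ×ˢ (univ : Set N), 0 < T - q.1 := fun q hq ↦ by
      have := hq.1.2; linarith
    refine ContinuousOn.mul hfc (ContinuousOn.sub (ContinuousOn.sub ?_ ?_) ?_)
    · exact continuousOn_const.div (continuousOn_const.mul hτc) fun q hq ↦
        (mul_pos two_pos (hτ0 q hq)).ne'
    · exact ((hFc.sub continuousOn_const).norm.pow 2).div (continuousOn_const.mul (hτc.pow 2))
        fun q hq ↦ (mul_pos four_pos (pow_pos (hτ0 q hq) 2)).ne'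
    · exact ((hFc.sub continuousOn_const).inner hDc).div (continuousOn_const.mul hτc)
        fun q hq ↦ (mul_pos two_pos (hτ0 q hq)).ne'
  have hfd : ∀ t ∈ Ioo a b, ∀ w, HasDerivAt (fun s ↦ (4 * Real.pi * (T - s)) ^ (-(n : ℝ) / 2) *
      Real.exp (-‖F s w - x₀‖ ^ 2 / (4 * (T - s))))
      ((4 * Real.pi * (T - t)) ^ (-(n : ℝ) / 2) * Real.exp (-‖F t w - x₀‖ ^ 2 / (4 * (T - t))) *
        ((n : ℝ) / (2 * (T - t)) - ‖F t w - x₀‖ ^ 2 / (4 * (T - t) ^ 2) -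
          ⟪F t w - x₀, deriv (fun s ↦ F s w) t⟫ / (2 * (T - t)))) t := fun t ht w ↦
    hasDerivAt_huiskenKernel_comp (hasDerivAt_slice hU hF (hIU (Ioo_subset_Icc_self ht)) w)
      (by linarith [ht.2]) x₀ n
  have hmain := h.hasDerivAt_integral_mul_density ht₀ hfc hf'c hfd
  refine hmain.congr_deriv ?_
  -- ### the value of the derivative: Huisken's rearrangement
  set μ₀ := riemannianMeasure ((euclideanMetric (EuclideanSpace ℝ (Fin (n + 1)))).inducedRiemannianMetric
    (F t₀) contMDiff_pullbackBilin_holds (h.isSpacelikeImmersion t₀ ht₀')) with hμ₀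
  have hsp := h.isSpacelikeImmersion t₀ ht₀'
  have hun := h.isUnitNormal t₀ ht₀'
  have hνl := h.contMDiff_normal t₀ ht₀'
  have hνs : ContMDiff (𝓡 n) 𝓘(ℝ, EuclideanSpace ℝ (Fin (n + 1))) ∞ (ν t₀) :=
    (contMDiff_of_contMDiff_lift hνl).2
  -- abbreviations (plain functions of `w`)
  set c : ℝ := (4 * Real.pi * (T - t₀)) ^ (-(n : ℝ) / 2) with hc
  set E : N → ℝ := fun w ↦ Real.exp (-‖F t₀ w - x₀‖ ^ 2 / (4 * (T - t₀))) with hE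
  set sν : N → ℝ := fun w ↦ ⟪F t₀ w - x₀, ν t₀ w⟫ with hsν
  set Hm : N → ℝ := fun w ↦ (euclideanMetric _).meanCurvature (F t₀) contMDiff_pullbackBilin_holds
    hsp (ν t₀) w with hHm
  -- `⟪y, ∂ₜF⟫ = -H ⟪y, ν⟫`
  have hvel : ∀ w, ⟪F t₀ w - x₀, deriv (fun s ↦ F s w) t₀⟫ = -Hm w * sν w := fun w ↦ by
    have hv : deriv (fun s ↦ F s w) t₀ = (-(Hm w)) • (show EuclideanSpace ℝ (Fin (n + 1)) from ν t₀ w) := by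
      rw [← mfderiv_slice_apply_one]
      exact h.velocity_eq t₀ ht₀' w
    rw [hv, real_inner_smul_right, neg_mul]
  -- the divergence identity `∫ c (tr Hess E - dE(ν) H) dμ₀ = 0`, in explicit form
  have hE2 : ContDiff ℝ 2 fun z : EuclideanSpace ℝ (Fin (n + 1)) ↦
      Real.exp (-‖z - x₀‖ ^ 2 / (4 * (T - t₀))) :=
    (contDiff_exp_neg_norm_sq_div x₀ (T - t₀)).of_le (by norm_cast)
  have hdiv := integral_trace_hessian_sub_mul_meanCurvature_eq_zero hsp hνl hun hE2
  have hpt : ∀ w, ((euclideanMetric (EuclideanSpace ℝ (Fin (n + 1)))).inducedMetric (F t₀)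
      contMDiff_pullbackBilin_holds hsp).trace w
      (((euclideanMetric (EuclideanSpace ℝ (Fin (n + 1)))).hessian
          (fun z ↦ Real.exp (-‖z - x₀‖ ^ 2 / (4 * (T - t₀)))) (F t₀ w)).comp
        (mfderiv (𝓡 n) 𝓘(ℝ, EuclideanSpace ℝ (Fin (n + 1))) (F t₀) w).toLinearMap
        (mfderiv (𝓡 n) 𝓘(ℝ, EuclideanSpace ℝ (Fin (n + 1))) (F t₀) w).toLinearMap) -
      mvfderiv 𝓘(ℝ, EuclideanSpace ℝ (Fin (n + 1)))
        (fun z ↦ Real.exp (-‖z - x₀‖ ^ 2 / (4 * (T - t₀)))) (F t₀ w) (ν t₀ w) * Hm w =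
      E w * ((‖F t₀ w - x₀‖ ^ 2 - sν w ^ 2) / (4 * (T - t₀) ^ 2) - (n : ℝ) / (2 * (T - t₀))) +
        E w / (2 * (T - t₀)) * sν w * Hm w := by
    intro w
    rw [trace_hessian_exp_comp hsp hun x₀ hτ.ne' w, mvfderiv_exp_neg_norm_sq_div_apply]
    simp only [hE, hsν]
    ring
  have hZ : ∫ w, (E w * ((‖F t₀ w - x₀‖ ^ 2 - sν w ^ 2) / (4 * (T - t₀) ^ 2) - (n : ℝ) / (2 * (T - t₀))) +
      E w / (2 * (T - t₀)) * sν w * Hm w) ∂μ₀ = 0 := by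
    rw [← hdiv]
    exact integral_congr_ae (Eventually.of_forall fun w ↦ (hpt w).symm)
  -- continuity of everything in `w`
  have hFt : Continuous (F t₀) := hsp.contMDiff.continuous
  have hEc : Continuous E := by
    simp only [hE]
    exact (((hFt.sub continuous_const).norm.pow 2).neg.div_const _).rexp
  have hsc : Continuous sν := by
    simp only [hsν]
    exact (hFt.sub continuous_const).inner hνs.continuous
  have hDc : Continuous fun w ↦ deriv (fun s ↦ F s w) t₀ :=
    (continuousOn_timeDeriv hU hF).comp_continuous (continuous_const.prodMk continuous_id)
      fun w ↦ ⟨hIU ht₀', mem_univ _⟩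
  have hHc : Continuous Hm := by
    have hfun : Hm = fun w ↦ -⟪deriv (fun s ↦ F s w) t₀, ν t₀ w⟫ :=
      funext fun w ↦ h.meanCurvature_eq_neg_inner_deriv ht₀' w
    rw [hfun]
    exact (hDc.inner hνs.continuous).neg
  haveI : IsFiniteMeasure μ₀ := isFiniteMeasure_riemannianMeasure _
  -- integrability of the two integrands
  have hIint : Integrable (fun w ↦ c * E w * ((n : ℝ) / (2 * (T - t₀)) -
      ‖F t₀ w - x₀‖ ^ 2 / (4 * (T - t₀) ^ 2) -
        ⟪F t₀ w - x₀, deriv (fun s ↦ F s w) t₀⟫ / (2 * (T - t₀))) - Hm w ^ 2 * (c * E w)) μ₀ := by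
    refine integrable_of_continuous (h := (euclideanMetric (EuclideanSpace ℝ (Fin (n + 1)))).inducedRiemannianMetric
      (F t₀) contMDiff_pullbackBilin_holds hsp) ?_
    refine ((continuous_const.mul hEc).mul ((continuous_const.sub ?_).sub ?_)).sub
      ((hHc.pow 2).mul (continuous_const.mul hEc))
    · exact ((hFt.sub continuous_const).norm.pow 2).div_const _
    · exact ((hFt.sub continuous_const).inner hDc).div_const _
  have hZint : Integrable (fun w ↦ c * (E w * ((‖F t₀ w - x₀‖ ^ 2 - sν w ^ 2) / (4 * (T - t₀) ^ 2) -
      (n : ℝ) / (2 * (T - t₀))) + E w / (2 * (T - t₀)) * sν w * Hm w)) μ₀ := by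
    refine integrable_of_continuous (h := (euclideanMetric (EuclideanSpace ℝ (Fin (n + 1)))).inducedRiemannianMetric
      (F t₀) contMDiff_pullbackBilin_holds hsp) (continuous_const.mul ?_)
    refine (hEc.mul ((((hFt.sub continuous_const).norm.pow 2).sub (hsc.pow 2)).div_const _
      |>.sub continuous_const)).add (((hEc.div_const _).mul hsc).mul hHc)
  -- ### assembly
  beta_reduce
  have hZc : ∫ w, c * (E w * ((‖F t₀ w - x₀‖ ^ 2 - sν w ^ 2) / (4 * (T - t₀) ^ 2) -
      (n : ℝ) / (2 * (T - t₀))) + E w / (2 * (T - t₀)) * sν w * Hm w) ∂μ₀ = 0 := by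
    rw [integral_const_mul, hZ, mul_zero]
  calc ∫ w, (c * E w * ((n : ℝ) / (2 * (T - t₀)) - ‖F t₀ w - x₀‖ ^ 2 / (4 * (T - t₀) ^ 2) -
        ⟪F t₀ w - x₀, deriv (fun s ↦ F s w) t₀⟫ / (2 * (T - t₀))) - Hm w ^ 2 * (c * E w)) ∂μ₀
      = ∫ w, (c * E w * ((n : ℝ) / (2 * (T - t₀)) - ‖F t₀ w - x₀‖ ^ 2 / (4 * (T - t₀) ^ 2) -
        ⟪F t₀ w - x₀, deriv (fun s ↦ F s w) t₀⟫ / (2 * (T - t₀))) - Hm w ^ 2 * (c * E w)) ∂μ₀ +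
        ∫ w, c * (E w * ((‖F t₀ w - x₀‖ ^ 2 - sν w ^ 2) / (4 * (T - t₀) ^ 2) -
          (n : ℝ) / (2 * (T - t₀))) + E w / (2 * (T - t₀)) * sν w * Hm w) ∂μ₀ := by rw [hZc, add_zero]
    _ = ∫ w, ((c * E w * ((n : ℝ) / (2 * (T - t₀)) - ‖F t₀ w - x₀‖ ^ 2 / (4 * (T - t₀) ^ 2) -
        ⟪F t₀ w - x₀, deriv (fun s ↦ F s w) t₀⟫ / (2 * (T - t₀))) - Hm w ^ 2 * (c * E w)) +
        c * (E w * ((‖F t₀ w - x₀‖ ^ 2 - sν w ^ 2) / (4 * (T - t₀) ^ 2) -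
          (n : ℝ) / (2 * (T - t₀))) + E w / (2 * (T - t₀)) * sν w * Hm w)) ∂μ₀ :=
        (integral_add hIint hZint).symm
    _ = ∫ w, -(c * E w * (Hm w - sν w / (2 * (T - t₀))) ^ 2) ∂μ₀ := by
        refine integral_congr_ae (Eventually.of_forall fun w ↦ ?_)
        dsimp only
        rw [hvel w]
        have hτ0 : T - t₀ ≠ 0 := hτ.ne'
        field_simp
        ring
    _ = -∫ w, c * E w * (Hm w - sν w / (2 * (T - t₀))) ^ 2 ∂μ₀ := integral_neg _

/-- **Huisken's monotonicity: the Gaussian integral is non-increasing** (`Φ'(t₀) ≤ 0`).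
[cite: Huisken1990, Thm. 3.1] -/
theorem IsClassicalMCF.deriv_gaussianIntegral_nonpos
    (h : IsClassicalMCF (euclideanMetric (EuclideanSpace ℝ (Fin (n + 1)))) F ν a b) {t₀ : ℝ}
    (ht₀ : t₀ ∈ Ioo a b) (x₀ : EuclideanSpace ℝ (Fin (n + 1))) {T : ℝ} (hT : b ≤ T) :
    deriv (fun t ↦ ∫ w, ((4 * Real.pi * (T - t)) ^ (-(n : ℝ) / 2) *
          Real.exp (-‖F t w - x₀‖ ^ 2 / (4 * (T - t)))) *
        (Real.sqrt (Matrix.of fun i j ↦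
          (euclideanMetric (EuclideanSpace ℝ (Fin (n + 1)))).inducedBilin (𝓡 n) (F t) w
            ((trivializationAt (EuclideanSpace ℝ (Fin n)) (TangentSpace (𝓡 n)) w).localFrame
              (EuclideanSpace.basisFun (Fin n) ℝ).toBasis i w)
            ((trivializationAt (EuclideanSpace ℝ (Fin n)) (TangentSpace (𝓡 n)) w).localFrame
              (EuclideanSpace.basisFun (Fin n) ℝ).toBasis j w)).det /
         Real.sqrt (Matrix.of fun i j ↦
          (euclideanMetric (EuclideanSpace ℝ (Fin (n + 1)))).inducedBilin (𝓡 n) (F t₀) w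
            ((trivializationAt (EuclideanSpace ℝ (Fin n)) (TangentSpace (𝓡 n)) w).localFrame
              (EuclideanSpace.basisFun (Fin n) ℝ).toBasis i w)
            ((trivializationAt (EuclideanSpace ℝ (Fin n)) (TangentSpace (𝓡 n)) w).localFrame
              (EuclideanSpace.basisFun (Fin n) ℝ).toBasis j w)).det)
        ∂riemannianMeasure ((euclideanMetric (EuclideanSpace ℝ (Fin (n + 1)))).inducedRiemannianMetric
          (F t₀) contMDiff_pullbackBilin_holds (h.isSpacelikeImmersion t₀ (Ioo_subset_Icc_self ht₀)))) t₀ ≤ 0 := by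
  rw [(h.hasDerivAt_gaussianIntegral ht₀ x₀ hT).deriv, neg_nonpos]
  refine integral_nonneg fun w ↦ ?_
  have hτ : 0 < T - t₀ := by linarith [ht₀.2]
  have hc : 0 ≤ (4 * Real.pi * (T - t₀)) ^ (-(n : ℝ) / 2) := Real.rpow_nonneg (by positivity) _
  exact mul_nonneg (mul_nonneg hc (Real.exp_pos _).le) (sq_nonneg _)

end Monotonicity

/-! ### The Gaussian integral is non-increasing -/

section GaussianIntegral

variable {n : ℕ} {N : Type*} [TopologicalSpace N] [ChartedSpace (EuclideanSpace ℝ (Fin n)) N]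
  [IsManifold (𝓡 n) ∞ N] [CompactSpace N] [T2Space N] [MeasurableSpace N] [BorelSpace N]
  {F : ℝ → N → EuclideanSpace ℝ (Fin (n + 1))}
  {ν : (t : ℝ) → NormalField (𝓡 (n + 1)) (F t)} {a b : ℝ}

/-- **The Gaussian integral does not depend on the reference measure**: for `t, r ∈ [a, b]`,
`∫_N ρ(F_t w, t) θ^{r}_t(w) dμ_r(w) = ∫_N ρ(F_t w, t) dμ_t(w)` (`integral_riemannianMeasure_eq`,
`MCFAreaEvolution.lean`). [cite: Mantegazza2011, §3.2] -/
theorem IsClassicalMCF.gaussianIntegral_eq_integral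
    (h : IsClassicalMCF (euclideanMetric (EuclideanSpace ℝ (Fin (n + 1)))) F ν a b) {t r : ℝ}
    (ht : t ∈ Icc a b) (hr : r ∈ Icc a b) (x₀ : EuclideanSpace ℝ (Fin (n + 1))) (T : ℝ) :
    ∫ w, ((4 * Real.pi * (T - t)) ^ (-(n : ℝ) / 2) *
          Real.exp (-‖F t w - x₀‖ ^ 2 / (4 * (T - t)))) *
        (Real.sqrt (Matrix.of fun i j ↦
          (euclideanMetric (EuclideanSpace ℝ (Fin (n + 1)))).inducedBilin (𝓡 n) (F t) w
            ((trivializationAt (EuclideanSpace ℝ (Fin n)) (TangentSpace (𝓡 n)) w).localFrame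
              (EuclideanSpace.basisFun (Fin n) ℝ).toBasis i w)
            ((trivializationAt (EuclideanSpace ℝ (Fin n)) (TangentSpace (𝓡 n)) w).localFrame
              (EuclideanSpace.basisFun (Fin n) ℝ).toBasis j w)).det /
         Real.sqrt (Matrix.of fun i j ↦
          (euclideanMetric (EuclideanSpace ℝ (Fin (n + 1)))).inducedBilin (𝓡 n) (F r) w
            ((trivializationAt (EuclideanSpace ℝ (Fin n)) (TangentSpace (𝓡 n)) w).localFrame
              (EuclideanSpace.basisFun (Fin n) ℝ).toBasis i w)
            ((trivializationAt (EuclideanSpace ℝ (Fin n)) (TangentSpace (𝓡 n)) w).localFrame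
              (EuclideanSpace.basisFun (Fin n) ℝ).toBasis j w)).det)
        ∂riemannianMeasure ((euclideanMetric (EuclideanSpace ℝ (Fin (n + 1)))).inducedRiemannianMetric
          (F r) contMDiff_pullbackBilin_holds (h.isSpacelikeImmersion r hr)) =
      ∫ w, (4 * Real.pi * (T - t)) ^ (-(n : ℝ) / 2) *
          Real.exp (-‖F t w - x₀‖ ^ 2 / (4 * (T - t)))
        ∂riemannianMeasure ((euclideanMetric (EuclideanSpace ℝ (Fin (n + 1)))).inducedRiemannianMetric
          (F t) contMDiff_pullbackBilin_holds (h.isSpacelikeImmersion t ht)) := by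
  rw [h.integral_riemannianMeasure_eq ht hr]
  refine integral_congr_ae (Eventually.of_forall fun w ↦ ?_)
  dsimp only
  rw [smul_eq_mul, mul_comm]

/-- **Huisken's monotonicity, monotone form**: along a classical mean curvature flow the Gaussian
integral `t ↦ ∫_{M_t} ρ_{x₀,T}(·, t) dμ_t` (written against the fixed reference measure `μ_r`,
`r ∈ [a, b]`) is non-increasing on `(a, b)` (`T ≥ b`). [cite: Huisken1990, Thm. 3.1]
[cite: Mantegazza2011, Thm. 3.2.7, Prop. 3.2.10] -/
theorem IsClassicalMCF.antitoneOn_gaussianIntegral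
    (h : IsClassicalMCF (euclideanMetric (EuclideanSpace ℝ (Fin (n + 1)))) F ν a b) {r : ℝ}
    (hr : r ∈ Icc a b) (x₀ : EuclideanSpace ℝ (Fin (n + 1))) {T : ℝ} (hT : b ≤ T) :
    AntitoneOn (fun t ↦ ∫ w, ((4 * Real.pi * (T - t)) ^ (-(n : ℝ) / 2) *
          Real.exp (-‖F t w - x₀‖ ^ 2 / (4 * (T - t)))) *
        (Real.sqrt (Matrix.of fun i j ↦
          (euclideanMetric (EuclideanSpace ℝ (Fin (n + 1)))).inducedBilin (𝓡 n) (F t) w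
            ((trivializationAt (EuclideanSpace ℝ (Fin n)) (TangentSpace (𝓡 n)) w).localFrame
              (EuclideanSpace.basisFun (Fin n) ℝ).toBasis i w)
            ((trivializationAt (EuclideanSpace ℝ (Fin n)) (TangentSpace (𝓡 n)) w).localFrame
              (EuclideanSpace.basisFun (Fin n) ℝ).toBasis j w)).det /
         Real.sqrt (Matrix.of fun i j ↦
          (euclideanMetric (EuclideanSpace ℝ (Fin (n + 1)))).inducedBilin (𝓡 n) (F r) w
            ((trivializationAt (EuclideanSpace ℝ (Fin n)) (TangentSpace (𝓡 n)) w).localFrame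
              (EuclideanSpace.basisFun (Fin n) ℝ).toBasis i w)
            ((trivializationAt (EuclideanSpace ℝ (Fin n)) (TangentSpace (𝓡 n)) w).localFrame
              (EuclideanSpace.basisFun (Fin n) ℝ).toBasis j w)).det)
        ∂riemannianMeasure ((euclideanMetric (EuclideanSpace ℝ (Fin (n + 1)))).inducedRiemannianMetric
          (F r) contMDiff_pullbackBilin_holds (h.isSpacelikeImmersion r hr))) (Ioo a b) := by
  -- at every `t₁ ∈ (a, b)` the function agrees near `t₁` with the one referred to `μ_{t₁}`, whose
  -- derivative at `t₁` is `≤ 0`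
  have hderiv : ∀ t₁ ∈ Ioo a b, ∃ D ≤ (0 : ℝ), HasDerivAt (fun t ↦ ∫ w, ((4 * Real.pi * (T - t)) ^ (-(n : ℝ) / 2) *
          Real.exp (-‖F t w - x₀‖ ^ 2 / (4 * (T - t)))) *
        (Real.sqrt (Matrix.of fun i j ↦
          (euclideanMetric (EuclideanSpace ℝ (Fin (n + 1)))).inducedBilin (𝓡 n) (F t) w
            ((trivializationAt (EuclideanSpace ℝ (Fin n)) (TangentSpace (𝓡 n)) w).localFrame
              (EuclideanSpace.basisFun (Fin n) ℝ).toBasis i w)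
            ((trivializationAt (EuclideanSpace ℝ (Fin n)) (TangentSpace (𝓡 n)) w).localFrame
              (EuclideanSpace.basisFun (Fin n) ℝ).toBasis j w)).det /
         Real.sqrt (Matrix.of fun i j ↦
          (euclideanMetric (EuclideanSpace ℝ (Fin (n + 1)))).inducedBilin (𝓡 n) (F r) w
            ((trivializationAt (EuclideanSpace ℝ (Fin n)) (TangentSpace (𝓡 n)) w).localFrame
              (EuclideanSpace.basisFun (Fin n) ℝ).toBasis i w)
            ((trivializationAt (EuclideanSpace ℝ (Fin n)) (TangentSpace (𝓡 n)) w).localFrame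
              (EuclideanSpace.basisFun (Fin n) ℝ).toBasis j w)).det)
        ∂riemannianMeasure ((euclideanMetric (EuclideanSpace ℝ (Fin (n + 1)))).inducedRiemannianMetric
          (F r) contMDiff_pullbackBilin_holds (h.isSpacelikeImmersion r hr))) D t₁ := by
    intro t₁ ht₁
    refine ⟨_, ?_, (h.hasDerivAt_gaussianIntegral ht₁ x₀ hT).congr_of_eventuallyEq ?_⟩
    · have hτ : 0 < T - t₁ := by linarith [ht₁.2]
      rw [neg_nonpos]
      refine integral_nonneg fun w ↦ ?_
      exact mul_nonneg (mul_nonneg (Real.rpow_nonneg (by positivity) _) (Real.exp_pos _).le)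
        (sq_nonneg _)
    · filter_upwards [isOpen_Ioo.mem_nhds ht₁] with t ht
      rw [h.gaussianIntegral_eq_integral (Ioo_subset_Icc_self ht) hr x₀ T,
        h.gaussianIntegral_eq_integral (Ioo_subset_Icc_self ht) (Ioo_subset_Icc_self ht₁) x₀ T]
  classical
  set D : ℝ → ℝ := fun t ↦ if ht : t ∈ Ioo a b then (hderiv t ht).choose else 0 with hD
  refine antitoneOn_of_hasDerivWithinAt_nonpos (convex_Ioo a b) (f' := D) (fun t ht ↦ ?_)
    (fun t ht ↦ ?_) (fun t ht ↦ ?_)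
  · obtain ⟨_, hd⟩ := (hderiv t ht).choose_spec
    exact hd.continuousAt.continuousWithinAt
  · rw [interior_Ioo] at ht ⊢
    obtain ⟨_, hd⟩ := (hderiv t ht).choose_spec
    have hDt : D t = (hderiv t ht).choose := by simp only [hD, dif_pos ht]
    rw [hDt]
    exact hd.hasDerivWithinAt
  · rw [interior_Ioo] at ht
    obtain ⟨hle, -⟩ := (hderiv t ht).choose_spec
    have hDt : D t = (hderiv t ht).choose := by simp only [hD, dif_pos ht]
    rw [hDt]
    exact hle

end GaussianIntegral

end Literature.Geometry.Riemannian

end
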